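import Summits.Ventures.PercRepro.C041BlockMapTriangleHosts
import Summits.Ventures.PercRepro.C041BlockMapPathHost

/-!
# ROW C-041 — THEOREM (CYCLE ⟸ TRIANGLE, BLOCK-MAP FORM): CONJECTURE (BLOCK MAP) for the triangle host
implies it for every two-exit cycle (p6, gen 36; the capstone of the block-map programme of the row, until now
in the zone formalism only: `inCone_sixVec_cyc2_of_tri2` of `C041CycleZone`)

Setting of `C041BlockMapTriangleHosts` (the triangle host `tri`, its exits `triExit` at `1` and `2`, anchor `0`,
and its seven loopified forms as cone hosts) and `C041BlockMapPathHost` / `C041BlockMapClosure` (the surgery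
`pathHost Z e₀ n` — an edge replaced by a path with `n` internal vertices — and its constructor `Built.path`,
which needs the host AND its loopified form).  THE CYCLE with the arcs of `n₁ + 1`, `n₂ + 1`, `n₃ + 1` segments
between the anchor and the exit `1`, the two exits, and the exit `2` and the anchor is the triangle with its
three edges replaced by paths (`cyc n₁ n₂ n₃`, the iterated `pathHost`; exits `cycExit`, anchor `cycAnchor`).
**THEOREM (CYCLE ⟸ TRIANGLE)** (`coneHost_cycle_of_tri`): if the triangle is a cone host then so is every cycle.
Proof: the derivation `built_cycle` applies `Built.path` to the three edges in turn; the loopified hosts it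
needs are read off the COMMUTATION `loopify (pathHost Z e₀ n) (inl e₁) = pathHost (loopify Z e₁) e₀ n`
(`loopify_pathHost`, an equality of hosts for `e₁ ≠ e₀`) down to the seven loopified triangles, which are cone
hosts unconditionally (`coneHost_tri_L0` … `coneHost_tri_L012`).  Hence the open core of the row is the
triangle alone: `ConeHost tri triExit 0` gives CONJECTURE (BLOCK MAP) for every two-exit cycle with arcs
`p, q, s ≥ 1`, and, through `sixVec_hang_eq_blockMap`, the cone membership of the six-vector of every zone
obtained by hanging two cone zones at the exits of a cycle.
-/

namespace PercRepro

namespace ZoneZ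

namespace MultiExit

open ZoneData Pendant Finset TwoExit TreeClosure

/-! ## The commutation of loopification with the path surgery -/

/-- Two hosts with the same end maps and the same terminal maps are equal. -/
theorem ZoneData.ext' {V E T₁ T₂ : Type} {Z Z' : ZoneData V E T₁ T₂} (h1 : Z.fst = Z'.fst) (h2 : Z.snd = Z'.snd)
    (h3 : Z.at₁ = Z'.at₁) (h4 : Z.at₂ = Z'.at₂) : Z = Z' := by
  cases Z
  cases Z'
  cases h1
  cases h2
  cases h3
  cases h4
  rfl

variable {V₁ E₁ U₁ U₂ : Type} (Z : ZoneData V₁ E₁ U₁ U₂) [DecidableEq E₁]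

/-- The second end of an edge of the loopified host, other than the looped edge. -/
theorem loopify_snd_of_ne {e₀ e : E₁} (h : e ≠ e₀) : (loopify Z e₀).snd e = Z.snd e := by
  show Function.update Z.snd e₀ (Z.fst e₀) e = Z.snd e
  rw [Function.update_of_ne h]

/-- The second end of the looped edge: its first end. -/
theorem loopify_snd_self (e₀ : E₁) : (loopify Z e₀).snd e₀ = Z.fst e₀ := by
  show Function.update Z.snd e₀ (Z.fst e₀) e₀ = Z.fst e₀
  rw [Function.update_self]

/-- The first ends of the loopified host are those of the host. -/
theorem loopify_fst (e₀ : E₁) : (loopify Z e₀).fst = Z.fst := rfl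

/-- The nodes of the path through `e₀` do not see a loop at another edge. -/
theorem pathNode_loopify {e₀ e₁ : E₁} (h : e₁ ≠ e₀) (n j : ℕ) :
    pathNode (loopify Z e₁) e₀ n j = pathNode Z e₀ n j := by
  unfold pathNode
  split_ifs
  · rfl
  · rw [loopify_snd_of_ne Z (Ne.symm h)]

/-- **The commutation**: looping an old edge `e₁` of the path host of `e₀` is the path host of `e₀` of the host
with `e₁` looped. -/
theorem loopify_pathHost {e₀ e₁ : E₁} (h : e₁ ≠ e₀) (n : ℕ) :
    loopify (pathHost Z e₀ n) (Sum.inl e₁) = pathHost (loopify Z e₁) e₀ n := by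
  refine ZoneData.ext' rfl ?_ rfl rfl
  funext e
  rcases e with e | i
  · by_cases he : e = e₁
    · subst he
      rw [loopify_snd_self, path_fst_inl, path_snd_inl_of_ne _ _ _ h, loopify_snd_self]
    · rw [loopify_snd_of_ne _ (fun h' => he (Sum.inl_injective h'))]
      by_cases he0 : e = e₀
      · subst he0
        rw [path_snd_inl_self, path_snd_inl_self, pathNode_loopify Z h]
      · rw [path_snd_inl_of_ne _ _ _ he0, path_snd_inl_of_ne _ _ _ he0, loopify_snd_of_ne _ he]
  · rw [loopify_snd_of_ne _ Sum.inr_ne_inl, path_snd_inr, path_snd_inr, pathNode_loopify Z h]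

/-! ## The cycle with three arcs -/

/-- THE CYCLE HOST with arcs of `n₁ + 1`, `n₂ + 1` and `n₃ + 1` segments: the triangle with its edge `0 → 1`
replaced by a path with `n₁` internal vertices, then its edge `1 → 2` by a path with `n₂`, then its edge
`2 → 0` by a path with `n₃`. -/
def cyc (n₁ n₂ n₃ : ℕ) :
    ZoneData (((Fin 3 ⊕ Fin n₁) ⊕ Fin n₂) ⊕ Fin n₃) (((Fin 3 ⊕ Fin n₁) ⊕ Fin n₂) ⊕ Fin n₃) Empty Empty :=
  pathHost (pathHost (pathHost tri 0 n₁) (Sum.inl 1) n₂) (Sum.inl (Sum.inl 2)) n₃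

/-- The exits of the cycle: the old vertices `1` and `2`. -/
def cycExit (n₁ n₂ n₃ : ℕ) : Unit ⊕ Unit → ((Fin 3 ⊕ Fin n₁) ⊕ Fin n₂) ⊕ Fin n₃ :=
  fun k => Sum.inl (Sum.inl (Sum.inl (triExit k)))

/-- The anchor of the cycle: the old vertex `0`. -/
def cycAnchor (n₁ n₂ n₃ : ℕ) : ((Fin 3 ⊕ Fin n₁) ⊕ Fin n₂) ⊕ Fin n₃ := Sum.inl (Sum.inl (Sum.inl 0))

/-! ## THEOREM (CYCLE EXPANSION) -/

/-- **THEOREM (CYCLE EXPANSION)**: the block map of the cycle is the combination of the block maps of the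
triangle and of its seven loopified forms with the coefficient `∏ (2 ^ nᵢ − 1)` over the looped edges — THEOREM
(PATH) applied to the three arcs, the loopified path hosts read off `loopify_pathHost`. -/
theorem blockMap_cycle (n₁ n₂ n₃ : ℕ) (w : Unit ⊕ Unit → Vec6) :
    blockMap (cyc n₁ n₂ n₃) (cycExit n₁ n₂ n₃) (cycAnchor n₁ n₂ n₃) w =
      blockMap tri triExit 0 w + ((2 : ℝ) ^ n₁ - 1) • blockMap (loopify tri 0) triExit 0 w +
        ((2 : ℝ) ^ n₂ - 1) • blockMap (loopify tri 1) triExit 0 w +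
        (((2 : ℝ) ^ n₂ - 1) * ((2 : ℝ) ^ n₁ - 1)) • blockMap (loopify (loopify tri 1) 0) triExit 0 w +
        ((2 : ℝ) ^ n₃ - 1) • blockMap (loopify tri 2) triExit 0 w +
        (((2 : ℝ) ^ n₃ - 1) * ((2 : ℝ) ^ n₁ - 1)) • blockMap (loopify (loopify tri 2) 0) triExit 0 w +
        (((2 : ℝ) ^ n₃ - 1) * ((2 : ℝ) ^ n₂ - 1)) • blockMap (loopify (loopify tri 2) 1) triExit 0 w +
        (((2 : ℝ) ^ n₃ - 1) * ((2 : ℝ) ^ n₂ - 1) * ((2 : ℝ) ^ n₁ - 1)) •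
          blockMap (loopify (loopify (loopify tri 2) 1) 0) triExit 0 w := by
  unfold cyc cycExit cycAnchor
  rw [blockMap_path, blockMap_path, blockMap_path,
    loopify_pathHost _ (Sum.inl_injective.ne (by decide)) n₂, loopify_pathHost tri (by decide) n₁,
    blockMap_path, blockMap_path, loopify_pathHost tri (by decide) n₁, blockMap_path,
    loopify_pathHost _ (by decide) n₁, blockMap_path]
  simp only [smul_add, smul_smul]
  module

/-! ## THEOREM (CYCLE ⟸ TRIANGLE) -/

/-- **The derivation**: if the triangle is a cone host, every cycle is built from it and its loopified forms
by three path surgeries. -/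
theorem built_cycle (h : ConeHost tri triExit 0) (n₁ n₂ n₃ : ℕ) :
    Built (cyc n₁ n₂ n₃) (cycExit n₁ n₂ n₃) (cycAnchor n₁ n₂ n₃) := by
  have h0 := Built.core _ _ _ h
  have hL0 := Built.core _ _ _ coneHost_tri_L0
  have hL1 := Built.core _ _ _ coneHost_tri_L1
  have hL2 := Built.core _ _ _ coneHost_tri_L2
  have hL01 := Built.core _ _ _ coneHost_tri_L01
  have hL02 := Built.core _ _ _ coneHost_tri_L02
  have hL12 := Built.core _ _ _ coneHost_tri_L12
  have hL012 := Built.core _ _ _ coneHost_tri_L012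
  -- the first arc
  have hA1 := Built.path tri 0 n₁ triExit 0 h0 hL0
  have hA2 : Built (loopify (pathHost tri 0 n₁) (Sum.inl 1)) (fun k => Sum.inl (triExit k)) (Sum.inl 0) := by
    rw [loopify_pathHost tri (by decide) n₁]
    exact Built.path _ 0 n₁ triExit 0 hL1 hL01
  -- the second arc
  have hA := Built.path _ (Sum.inl 1) n₂ _ _ hA1 hA2
  have hB1 := Built.path (loopify tri 2) 0 n₁ triExit 0 hL2 hL02
  have hB2 : Built (loopify (pathHost (loopify tri 2) 0 n₁) (Sum.inl 1)) (fun k => Sum.inl (triExit k))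
      (Sum.inl 0) := by
    rw [loopify_pathHost _ (by decide) n₁]
    exact Built.path _ 0 n₁ triExit 0 hL12 hL012
  have hB : Built (loopify (pathHost (pathHost tri 0 n₁) (Sum.inl 1) n₂) (Sum.inl (Sum.inl 2)))
      (fun k => Sum.inl (Sum.inl (triExit k))) (Sum.inl (Sum.inl 0)) := by
    rw [loopify_pathHost _ (Sum.inl_injective.ne (by decide)) n₂, loopify_pathHost tri (by decide) n₁]
    exact Built.path _ (Sum.inl 1) n₂ _ _ hB1 hB2
  -- the third arc
  exact Built.path _ (Sum.inl (Sum.inl 2)) n₃ _ _ hA hB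

/-- **THEOREM (CYCLE ⟸ TRIANGLE, BLOCK-MAP FORM)**: if the triangle host is a cone host, every two-exit cycle
with arcs of `n₁ + 1`, `n₂ + 1`, `n₃ + 1` segments is a cone host — CONJECTURE (BLOCK MAP) for all cycles
follows from its case of the triangle. -/
theorem coneHost_cycle_of_tri (h : ConeHost tri triExit 0) (n₁ n₂ n₃ : ℕ) :
    ConeHost (cyc n₁ n₂ n₃) (cycExit n₁ n₂ n₃) (cycAnchor n₁ n₂ n₃) :=
  coneHost_of_built (built_cycle h n₁ n₂ n₃)

end MultiExit

end ZoneZ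

end PercRepro
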